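import Summits.ResolutionOfSingularities.ResolutionOfSingularities.Theses.AbhyankarShadows
import Summits.ResolutionOfSingularities.ResolutionOfSingularities.Theses.IndSmooth
import Summits.ResolutionOfSingularities.ResolutionOfSingularities.Theorems.FrobeniusClosingPatchingRelPerfectOfAtomDimFour
import Literature.AlgebraicGeometry.Resolution.ResolutionOfComponents
import Mathlib.RingTheory.EssentialFiniteness
import HarnessLib

/-!
# Crux `PatchingPerfect` (stmt-ResolutionOfSingularities-16089) — line `birth`, lead RESHAPE v5:
# ZARISKI–TEMKIN ATOMIZATION IN ALL DIMENSIONS (fibrewise; no global residual)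

Shared crux (rank 4) of routes `ResolutionOfSingularities/IndSmooth` and
`ResolutionOfSingularities/AbhyankarShadows` (verbatim the same `def`):
`PatchingPerfect` = "for every prime `p` and every PERFECT field `k` of characteristic `p`: relative
local uniformization over `k` (`RelLUAt k`) implies weak resolution of every reduced separated
`k`-scheme of finite type (`ResolvesAt k`)" — Zariski's patching programme over ONE perfect field.

## History

* v1 (planner): Piltant's Axiom 4 + bad points + Liu 8.1.24. v2/v3 (lead seat 0): one exact
  crux-equivalent stub (certificate p166235); promote-stub.
* v4 (lead seat c1): dimension-graded, fibrewise, through the LANDED closed-point-slice engine of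
  the sibling crux `PatchingRelPerfect` (stmt-16161): crux BY NAME ⇐ printed ∧ `stub_atomDimFour`
  (16161's registered atom, verbatim) ∧ a FIBREWISE dimension-`≥ 5` residual (certificate LANDED,
  `Theorems.patchingPerfect_of_printed_of_atomDimFour_of_dimGeFiveAt`, p172124).
* v5 (this file): **the dimension-`≥ 5` residual is ATOMIZED.** The sibling's engine stops at
  dimension 4 because its non-closed step feeds on the PRINTED dimension-3 theorems through a
  generic fibre ("no perfect-only dimension induction", BN-P1). But non-closed bad points can be
  treated exactly like closed ones — under a REGULAR ROOF, by a punctual sandwiched atom at the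
  (regular, essentially-of-finite-type) local ring of the roof point — provided (i) one works over
  ONE regular base at a time (restrict the join `N` to `U_i = q_i⁻¹(Reg N_i)`, which is PROPER and
  birational over the regular `k`-variety `Reg N_i`), (ii) the step is taken at a bad point whose
  image `n` is MAXIMAL in the image of the bad locus (then the local scheme
  `X' ×_B Spec 𝒪_{B,n}` is regular off its closed fibre), (iii) at non-closed `n` the atom is in
  SING-FORMAT (centre inside the singular locus — Temkin's `AdmitsDesingularization` format), so
  that the largest extension of the centre (Temkin L.2.1.1,
  `exists_idealSheaf_extension_fromSpecStalk`) stays inside `Sing`, and (iv) the finitely many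
  regular bases are processed one after the other, each partial desingularization being extended
  from the open `U_i` to the whole current model by the push-forward ideal
  (`Theorems.exists_isPullback_of_isBlowup_opens`) — safe because its cosupport is
  `⊆ Sing ∪` (fibres over finitely many CLOSED roof points, closed and inside `U_i`). No printed
  theorem, no generic fibre, no dimension bound and no perfectness is used by this engine;
  perfectness of `k` only feeds the CLOSED atom of dimension 4 in the shared complete form
  (`stub_atomDimFour`, through the landed `Theorems.stub_algebraizeBlowup`).

  Consequently the crux is, in ALL dimensions,
  `printed(≤ 3) ∧ atomDimFour ∧ higherAtoms` + four TRUE engine statements, where `higherAtoms`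
  = (closed fibre-format atoms of dimension `≥ 5`) ∧ (non-closed Sing-format atoms of dimension
  `≥ 4`), all LOCAL statements about sandwiched singularities over regular local rings
  essentially of finite type over `k`. The same engine serves `PatchingRelPerfect` (16161) and,
  with the closed dimension-4 atom taken over all residue fields, the all-fields crux
  `PatchingRel` (0642).

## The stubs (7 = stubs_max)

OPEN (parked / shared):
* `stub_printedInputs` — printed CP 2019 Thm 1.1 / Prop 4.4, CJS 2020 Thm 1.2 format (= 16161's).
* `stub_atomDimFour` — THE SHARED OPEN CORE (= 16161's registered stub verbatim): closed
  fibre-format atom over complete regular local fourfold bases with perfect residue field.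
* `stub_higherAtoms` — (closed, eft, residue finite over `k`, dim `≥ 5`, fibre-format) ∧
  (non-closed, eft, residue NOT finite over `k`, dim `≥ 4`, Sing-format). Open; parked; replaces
  the global residual `stub_dimGeFiveAt` of v4 by local atoms.

TRUE (engine; to be proved on this line):
* `stub_regularBaseEngine` (E1, lead) — Temkin's Noetherian induction over ONE regular base,
  closed steps fibre-format (tree `stub_roofEngineClosedStep` pattern), non-closed steps at
  maximal image points in Sing-format; output: a blow-up with regular source whose centre misses
  the generic point and is cosupported in `Sing M ∪ q⁻¹(F)`, `F` a finite set of closed points.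
* `stub_multiRoofGluing` (E2) — finitely many regular roofs covering `N` + E1-outputs over the
  regular loci ⇒ `N` has a resolution (push-forward extension from opens, invariant "regular over
  the bases already processed").
* `stub_sliceAllDim` (E3) — LU at `k` ⇒ finite resolving system ⇒ iterated join with a finite
  covering family of regular roofs ⇒ E2 ⇒ resolution of every integral separated finite-type
  `X/k`, ANY dimension.
* `stub_nonClosedAtomDimLeThree` (E5) — the Sing-format eft atom in dimension `≤ 3` from the
  printed theorems (tree `stub_atomDimLeThree` pattern, `T` excellent of dimension `≤ 3`).

Composition (kernel-checked): `PatchingPerfect_of : Sig.stub_printedInputs → Sig.stub_atomDimFour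
→ Sig.stub_higherAtoms → Sig.stub_regularBaseEngine → Sig.stub_multiRoofGluing →
Sig.stub_sliceAllDim → Sig.stub_nonClosedAtomDimLeThree → PatchingPerfect`.

Hardest stub: `stub_regularBaseEngine` (lead). Wave 1: E2, E3, E5 (workers).

Barriers: `DimensionFourFrontier` — honoured: every open input is a local atom of dimension
`≥ 4`; `InseparableBaseChange` / `RegularNotGeometricallyRegular` — do not bite (no base change
of the ground field anywhere; non-closed points are treated at their own local rings, whose
imperfect residue fields enter only the STATEMENT of the non-closed atoms); kangaroo /
Hauser–Perlega — bite on invariant-driven proofs of the atoms, not on the cut.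

Disproof used (`Cruxes/PatchingPerfect/Disproof.lean`, g1 + g2, unchanged): §1 (a kill needs LU
over a perfect field in all trdeg AND a non-resolvable variety) — the atoms inherit nothing
refutable; the sibling's `Theorems/PatchingRelPerfect/Negative/{PunctualAtom,LoadBearing}` apply
to `stub_atomDimFour` verbatim.
-/

noncomputable section

-- single-problem summit: the doubled namespace component `ResolutionOfSingularities` is forced
set_option linter.dupNamespace false

open CategoryTheory AlgebraicGeometry TopologicalSpace
open Literature.AlgebraicGeometry.Resolution
open Summit.ResolutionOfSingularities.ResolutionOfSingularities.Theorems
open Summit.ResolutionOfSingularities.ResolutionOfSingularities.Theses.AbhyankarShadows (PatchingPerfect)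

namespace Summit.ResolutionOfSingularities.ResolutionOfSingularities.Cruxes.PatchingPerfect.Lines.Birth

/-! ## The predicates (slices at ONE ground field `k`; verbatim bodies of tree statements) -/

/-- **Relative local uniformization over `k`** — the ANTECEDENT of the crux at `(p, k)`, verbatim.
[cite: ZariskiSamuel1960, Ch. VI §17 (shape)] -/
def RelLUAt (k : Type) [Field k] : Prop :=
  ∀ (K : Type) [Field K] [Algebra k K], (⊤ : IntermediateField k K).FG →
    ∀ O : ValuationSubring K, (∀ c : k, algebraMap k K c ∈ O) → ∀ R : Subalgebra k K, R.FG →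
      R.toSubring ≤ O.toSubring → ∃ (A : Subalgebra k K) (h : A.toSubring ≤ O.toSubring),
        R ≤ A ∧ A.FG ∧ IsFractionRing A K ∧ IsRegularLocalRing (Localization.AtPrime
          (Ideal.comap (Subring.inclusion h) (IsLocalRing.maximalIdeal O)))

/-- **Weak resolution of every reduced separated `k`-scheme of finite type** — the CONSEQUENT of
the crux at `(p, k)`, verbatim. [folklore] -/
def ResolvesAt (k : Type) [Field k] : Prop :=
  ∀ (X : Scheme.{0}) (f : X ⟶ Spec (.of k)), IsSeparated f → LocallyOfFiniteType f →
    QuasiCompact f → IsReduced X → Scheme.HasResolution X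

/-- **Fibre-format punctual atom at a local base `S`**: every integral `T` proper and birational
over `Spec S`, regular off the closed fibre, carries a non-zero ideal sheaf cosupported in the
closed fibre with regular blowing up (the format of the CLOSED steps).
[cite: Temkin2008, Prop. 2.3.4 (iii) (shape)] [cite: CossartPiltant2019, Thm. 1.1 (ii) and Prop. 4.4] -/
def AtomAt (S : Type) [CommRing S] [IsLocalRing S] : Prop :=
  ∀ (T : Scheme.{0}) (f : T ⟶ Spec (.of S)), IsIntegral T → IsProper f → IsBirational f →
    (∀ t : T, f.base t ≠ IsLocalRing.closedPoint S → IsRegularLocalRing (T.presheaf.stalk t)) →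
    ∃ (J : T.IdealSheafData) (T' : Scheme.{0}) (π : T' ⟶ T), J ≠ ⊥ ∧
      (∀ t : T, t ∈ J.support → f.base t = IsLocalRing.closedPoint S) ∧
      IsBlowup π J ∧ Scheme.IsRegular T'

/-- **Sing-format punctual atom at a local base `S`** (Temkin's desingularization format): as
`AtomAt`, with the centre cosupported in the SINGULAR locus of `T` (hence in the closed fibre).
The format of the NON-CLOSED steps. [cite: Temkin2008, Def. 2.2.6 and Lemma 2.1.1] -/
def SingAtomAt (S : Type) [CommRing S] [IsLocalRing S] : Prop :=
  ∀ (T : Scheme.{0}) (f : T ⟶ Spec (.of S)), IsIntegral T → IsProper f → IsBirational f →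
    (∀ t : T, f.base t ≠ IsLocalRing.closedPoint S → IsRegularLocalRing (T.presheaf.stalk t)) →
    ∃ (J : T.IdealSheafData) (T' : Scheme.{0}) (π : T' ⟶ T), J ≠ ⊥ ∧
      (∀ t : T, t ∈ J.support → ¬ IsRegularLocalRing (T.presheaf.stalk t)) ∧
      IsBlowup π J ∧ Scheme.IsRegular T'

/-- **Output of the engine over one regular base** `q : M → B`: a blowing up of `M` with regular
source whose centre misses the generic point and is cosupported in `Sing M ∪ q⁻¹(F)` for a finite
set `F` of closed points of `B`. [cite: Temkin2008, Prop. 2.3.4 (proof, p. 12)] -/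
def EngineOut {M B : Scheme.{0}} [IsIntegral M] (q : M ⟶ B) : Prop :=
  ∃ (J : M.IdealSheafData) (M' : Scheme.{0}) (π : M' ⟶ M), IsBlowup π J ∧
    genericPoint M ∉ (J.support : Set M) ∧
    (∃ F : Set B, F.Finite ∧ (∀ n ∈ F, IsClosed ({n} : Set B)) ∧
      ∀ m : M, m ∈ J.support → m ∉ Scheme.regularLocus M ∨ q.base m ∈ F) ∧
    Scheme.IsRegular M'

/-- **A finite covering family of regular roofs resolves**: the conclusion shape of
`stub_multiRoofGluing`, as consumed by `stub_sliceAllDim`. [cite: Piltant2013, Prop. 5.1 (shape)] -/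
def RoofFamiliesResolve (k : Type) [Field k] : Prop :=
  ∀ (d : ℕ) (N : Scheme.{0}) (gN : N ⟶ Spec (.of k)) [IsSeparated gN] [LocallyOfFiniteType gN]
    [QuasiCompact gN] [IsIntegral N] (ι : Type) [Finite ι] (N' : ι → Scheme.{0})
    (g' : (i : ι) → (N' i ⟶ Spec (.of k))) [∀ i, LocallyOfFiniteType (g' i)]
    [∀ i, QuasiCompact (g' i)] [∀ i, IsIntegral (N' i)],
    (∀ i, topologicalKrullDim (N' i) ≤ d) →
    ∀ (q : (i : ι) → (N ⟶ N' i)) [∀ i, IsProper (q i)], (∀ i, IsBirational (q i)) →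
      (∀ n : N, ∃ i, IsRegularLocalRing ((N' i).presheaf.stalk ((q i).base n))) →
      Scheme.HasResolution N

/-! ## Sanity (proved): the crux is `RelLUAt → ResolvesAt`, the two route copies agree -/

/-- The crux, unfolded (definitional). [folklore] -/
theorem patchingPerfect_iff :
    PatchingPerfect ↔ ∀ p : ℕ, p.Prime → ∀ (k : Type) [Field k] [CharP k p] [PerfectField k],
      RelLUAt k → ResolvesAt k :=
  Iff.rfl

/-- The two route copies of the crux are the same statement (definitional). [folklore] -/
theorem indSmooth_patchingPerfect_iff :
    Summit.ResolutionOfSingularities.ResolutionOfSingularities.Theses.IndSmooth.PatchingPerfect ↔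
      PatchingPerfect :=
  Iff.rfl

/-! ## The stub STATEMENTS by name (`Sig.stub_<name>`; `PatchingPerfect_of` takes exactly these) -/

/-- Statement of `stub_printedInputs` (identical to stmt-16161's).
[cite: CossartPiltant2019, Thm. 1.1 and Prop. 4.4] [cite: CossartJannsenSaito2020, Thm. 1.2] -/
def Sig.stub_printedInputs : Prop :=
  CossartPiltant2019General.{0} ∧ CossartPiltant2019Principalization.{0} ∧
    ∀ (X : Scheme.{0}) [IsNoetherian X] [IsReduced X], Scheme.IsExcellent X →
      topologicalKrullDim X ≤ 2 → Scheme.AdmitsDesingularization X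

/-- Statement of `stub_atomDimFour` (identical to stmt-16161's).
[cite: CossartPiltant2019, §5 p. 58 (the dimension-4 step is open)] -/
def Sig.stub_atomDimFour : Prop :=
  ∀ p : ℕ, p.Prime → ∀ (S : Type) [CommRing S] [IsRegularLocalRing S] [CharP S p]
    [IsAdicComplete (IsLocalRing.maximalIdeal S) S] [PerfectField (IsLocalRing.ResidueField S)],
    ringKrullDim S = (4 : ℕ) → AtomAt S

/-- Statement of `stub_higherAtoms`: closed fibre-format atoms of dimension `≥ 5` and non-closed
Sing-format atoms of dimension `≥ 4`, at regular local rings essentially of finite type over a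
perfect field. [cite: Piltant2013, p. 2 (open in dimension ≥ 4)] -/
def Sig.stub_higherAtoms : Prop :=
  (∀ p : ℕ, p.Prime → ∀ (k : Type) [Field k] [CharP k p] [PerfectField k] (S : Type) [CommRing S]
    [IsRegularLocalRing S] [Algebra k S] [Algebra.EssFiniteType k S],
    ¬ ringKrullDim S ≤ (4 : ℕ) → Module.Finite k (S ⧸ IsLocalRing.maximalIdeal S) → AtomAt S) ∧
  (∀ p : ℕ, p.Prime → ∀ (k : Type) [Field k] [CharP k p] [PerfectField k] (S : Type) [CommRing S]
    [IsRegularLocalRing S] [Algebra k S] [Algebra.EssFiniteType k S],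
    ¬ ringKrullDim S ≤ (3 : ℕ) → ¬ Module.Finite k (S ⧸ IsLocalRing.maximalIdeal S) → SingAtomAt S)

/-- Statement of `stub_regularBaseEngine` (E1). [cite: Temkin2008, Prop. 2.3.4] -/
def Sig.stub_regularBaseEngine : Prop :=
  ∀ (d : ℕ) (k : Type) [Field k],
    (∀ (S : Type) [CommRing S] [IsRegularLocalRing S] [Algebra k S] [Algebra.EssFiniteType k S],
      ringKrullDim S ≤ (d : ℕ) → Module.Finite k (S ⧸ IsLocalRing.maximalIdeal S) → AtomAt S) →
    (∀ (S : Type) [CommRing S] [IsRegularLocalRing S] [Algebra k S] [Algebra.EssFiniteType k S],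
      ringKrullDim S < (d : ℕ) → ¬ Module.Finite k (S ⧸ IsLocalRing.maximalIdeal S) →
        SingAtomAt S) →
    ∀ (B M : Scheme.{0}) (gB : B ⟶ Spec (.of k)) [LocallyOfFiniteType gB] [QuasiCompact gB]
      [IsIntegral B], Scheme.IsRegular B → topologicalKrullDim B ≤ d →
      ∀ (q : M ⟶ B) [IsProper q] [IsIntegral M], IsBirational q → EngineOut q

/-- Statement of `stub_multiRoofGluing` (E2). [cite: Piltant2013, Prop. 5.1 (proof, Step 2)] -/
def Sig.stub_multiRoofGluing : Prop :=
  ∀ (d : ℕ) (k : Type) [Field k],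
    (∀ (B M : Scheme.{0}) (gB : B ⟶ Spec (.of k)) [LocallyOfFiniteType gB] [QuasiCompact gB]
      [IsIntegral B], Scheme.IsRegular B → topologicalKrullDim B ≤ d →
      ∀ (q : M ⟶ B) [IsProper q] [IsIntegral M], IsBirational q → EngineOut q) →
    ∀ (N : Scheme.{0}) (gN : N ⟶ Spec (.of k)) [IsSeparated gN] [LocallyOfFiniteType gN]
      [QuasiCompact gN] [IsIntegral N] (ι : Type) [Finite ι] (N' : ι → Scheme.{0})
      (g' : (i : ι) → (N' i ⟶ Spec (.of k))) [∀ i, LocallyOfFiniteType (g' i)]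
      [∀ i, QuasiCompact (g' i)] [∀ i, IsIntegral (N' i)],
      (∀ i, topologicalKrullDim (N' i) ≤ d) →
      ∀ (q : (i : ι) → (N ⟶ N' i)) [∀ i, IsProper (q i)], (∀ i, IsBirational (q i)) →
        (∀ n : N, ∃ i, IsRegularLocalRing ((N' i).presheaf.stalk ((q i).base n))) →
        Scheme.HasResolution N

/-- Statement of `stub_sliceAllDim` (E3). [cite: Zariski1944, p. 539] [cite: Piltant2013, Cor. 5.7] -/
def Sig.stub_sliceAllDim : Prop :=
  ∀ (k : Type) [Field k], RelLUAt k → RoofFamiliesResolve k →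
    ∀ (X : Scheme.{0}) (f : X ⟶ Spec (.of k)), IsSeparated f → LocallyOfFiniteType f →
      QuasiCompact f → IsIntegral X → Scheme.HasResolution X

/-- Statement of `stub_nonClosedAtomDimLeThree` (E5).
[cite: CossartPiltant2019, Thm. 1.1 and Prop. 4.4] [cite: CossartJannsenSaito2020, Thm. 1.2] -/
def Sig.stub_nonClosedAtomDimLeThree : Prop :=
  Sig.stub_printedInputs →
    ∀ (k : Type) [Field k] (S : Type) [CommRing S] [IsRegularLocalRing S] [Algebra k S]
      [Algebra.EssFiniteType k S], ringKrullDim S ≤ (3 : ℕ) → SingAtomAt S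

/-! ## The stubs -/

/-- **STUB (printed, vendored; identical to stmt-16161's `stub_printedInputs`).** Cossart–Piltant
2019 Thm. 1.1 as printed and Prop. 4.4; Cossart–Jannsen–Saito 2020 Thm. 1.2 in single-blow-up
format. Literature-prover debt, not a research target.
[cite: CossartPiltant2019, Thm. 1.1 and Prop. 4.4] [cite: CossartJannsenSaito2020, Thm. 1.2] -/
theorem stub_printedInputs :
    CossartPiltant2019General.{0} ∧ CossartPiltant2019Principalization.{0} ∧
      ∀ (X : Scheme.{0}) [IsNoetherian X] [IsReduced X], Scheme.IsExcellent X →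
        topologicalKrullDim X ≤ 2 → Scheme.AdmitsDesingularization X := by
  sorry

/-- **STUB — THE SHARED OPEN CORE (identical to stmt-16161's `stub_atomDimFour`).** For `S`
complete regular local of dimension `4`, characteristic `p`, perfect residue field, and `T`
integral, proper and birational over `Spec S`, regular off the closed fibre: a non-zero ideal
sheaf on `T` cosupported in the closed fibre with regular blowing up. "Cossart–Piltant one
dimension up". [cite: CossartPiltant2019, Thm. 1.1 (ii), Prop. 4.4, and §5 p. 58]
[cite: Temkin2008, Prop. 2.3.4 (iii)] -/
theorem stub_atomDimFour (p : ℕ) (hp : p.Prime) (S : Type) [CommRing S] [IsRegularLocalRing S]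
    [CharP S p] [IsAdicComplete (IsLocalRing.maximalIdeal S) S]
    [PerfectField (IsLocalRing.ResidueField S)] (hdim : ringKrullDim S = (4 : ℕ))
    (T : Scheme.{0}) (f : T ⟶ Spec (.of S)) [IsIntegral T] [IsProper f] (hbir : IsBirational f)
    (hoff : ∀ t : T, f.base t ≠ IsLocalRing.closedPoint S → IsRegularLocalRing (T.presheaf.stalk t)) :
    ∃ (J : T.IdealSheafData) (T' : Scheme.{0}) (π : T' ⟶ T), J ≠ ⊥ ∧
      (∀ t : T, t ∈ J.support → f.base t = IsLocalRing.closedPoint S) ∧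
      IsBlowup π J ∧ Scheme.IsRegular T' := by
  sorry

/-- **STUB — the HIGHER ATOMS (open; parked; local).** (1) CLOSED atoms of dimension `≥ 5`: for a
regular local ring `S` essentially of finite type over a perfect field `k` of characteristic `p`,
with residue field finite over `k` and `dim S ≥ 5`, every integral `T` proper and birational over
`Spec S`, regular off the closed fibre, has a fibre-cosupported non-zero ideal with regular
blowing up. (2) NON-CLOSED atoms of dimension `≥ 4`: the same for `S` with residue field NOT
finite over `k` and `dim S ≥ 4`, with the centre inside the singular locus of `T`. Both are
resolution, in blow-up format, of sandwiched singularities of dimension `≥ 4`: open. They replace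
the global dimension-`≥ 5` residual of v4. [cite: Piltant2013, p. 2] [cite: Temkin2008, Def. 2.2.6] -/
theorem stub_higherAtoms :
    (∀ p : ℕ, p.Prime → ∀ (k : Type) [Field k] [CharP k p] [PerfectField k] (S : Type) [CommRing S]
      [IsRegularLocalRing S] [Algebra k S] [Algebra.EssFiniteType k S],
      ¬ ringKrullDim S ≤ (4 : ℕ) → Module.Finite k (S ⧸ IsLocalRing.maximalIdeal S) →
      ∀ (T : Scheme.{0}) (f : T ⟶ Spec (.of S)), IsIntegral T → IsProper f → IsBirational f →
        (∀ t : T, f.base t ≠ IsLocalRing.closedPoint S → IsRegularLocalRing (T.presheaf.stalk t)) →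
        ∃ (J : T.IdealSheafData) (T' : Scheme.{0}) (π : T' ⟶ T), J ≠ ⊥ ∧
          (∀ t : T, t ∈ J.support → f.base t = IsLocalRing.closedPoint S) ∧
          IsBlowup π J ∧ Scheme.IsRegular T') ∧
    (∀ p : ℕ, p.Prime → ∀ (k : Type) [Field k] [CharP k p] [PerfectField k] (S : Type) [CommRing S]
      [IsRegularLocalRing S] [Algebra k S] [Algebra.EssFiniteType k S],
      ¬ ringKrullDim S ≤ (3 : ℕ) → ¬ Module.Finite k (S ⧸ IsLocalRing.maximalIdeal S) →
      ∀ (T : Scheme.{0}) (f : T ⟶ Spec (.of S)), IsIntegral T → IsProper f → IsBirational f →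
        (∀ t : T, f.base t ≠ IsLocalRing.closedPoint S → IsRegularLocalRing (T.presheaf.stalk t)) →
        ∃ (J : T.IdealSheafData) (T' : Scheme.{0}) (π : T' ⟶ T), J ≠ ⊥ ∧
          (∀ t : T, t ∈ J.support → ¬ IsRegularLocalRing (T.presheaf.stalk t)) ∧
          IsBlowup π J ∧ Scheme.IsRegular T') := by
  sorry

/-- **STUB E1 — THE ENGINE OVER ONE REGULAR BASE (true; Temkin's Noetherian induction).** Let
`k` be a field, `B` an integral REGULAR `k`-scheme of finite type of dimension `≤ d`, and
`q : M → B` proper and birational with `M` integral. Assume the closed atoms (fibre-format, at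
regular local `k`-algebras essentially of finite type of dimension `≤ d` with residue field finite
over `k`) and the non-closed atoms (Sing-format, dimension `< d`, residue field not finite over
`k`). Then `M` has a blowing up `π : M' → M` with `M'` regular, along an ideal whose cosupport
misses the generic point and is contained in `Sing M ∪ q⁻¹(F)` for a finite set `F` of closed
points of `B`. PROOF PATTERN: `Theorems.stub_roofEngine` (well-founded induction on the closed
bad set `C ⊆ Sing M`, carrying a blowing up `X' → M` regular off `C`), with the step taken at a
point `x ∈ C` whose image `n = q x` is MAXIMAL in the closed set `q(C)`: the local scheme
`T = X' ×_B Spec 𝒪_{B,n}` is then integral, proper and birational over the regular local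
`𝒪_{B,n}` (essentially of finite type over `k`, `dim ≤ d`, and `< d` with residue field not
finite over `k` when `n` is not closed) and regular off its closed fibre; the atom's centre is
extended by `exists_idealSheaf_extension_fromSpecStalk` (cosupport = closure: inside `(q f)⁻¹(n)`
for closed `n`, inside `Sing X'` in Sing-format), and `Theorems.stub_roofEngineClosedStep`'s
argument shows the new bad set is closed, inside `C`, and misses `x`.
[cite: Temkin2008, Prop. 2.3.4 (proof, p. 12), Lemma 2.1.1, Lemma 2.1.4] -/
theorem stub_regularBaseEngine (d : ℕ) (k : Type) [Field k]
    (hC : ∀ (S : Type) [CommRing S] [IsRegularLocalRing S] [Algebra k S] [Algebra.EssFiniteType k S],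
      ringKrullDim S ≤ (d : ℕ) → Module.Finite k (S ⧸ IsLocalRing.maximalIdeal S) →
      ∀ (T : Scheme.{0}) (f : T ⟶ Spec (.of S)), IsIntegral T → IsProper f → IsBirational f →
        (∀ t : T, f.base t ≠ IsLocalRing.closedPoint S → IsRegularLocalRing (T.presheaf.stalk t)) →
        ∃ (J : T.IdealSheafData) (T' : Scheme.{0}) (π : T' ⟶ T), J ≠ ⊥ ∧
          (∀ t : T, t ∈ J.support → f.base t = IsLocalRing.closedPoint S) ∧
          IsBlowup π J ∧ Scheme.IsRegular T')
    (hN : ∀ (S : Type) [CommRing S] [IsRegularLocalRing S] [Algebra k S] [Algebra.EssFiniteType k S],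
      ringKrullDim S < (d : ℕ) → ¬ Module.Finite k (S ⧸ IsLocalRing.maximalIdeal S) →
      ∀ (T : Scheme.{0}) (f : T ⟶ Spec (.of S)), IsIntegral T → IsProper f → IsBirational f →
        (∀ t : T, f.base t ≠ IsLocalRing.closedPoint S → IsRegularLocalRing (T.presheaf.stalk t)) →
        ∃ (J : T.IdealSheafData) (T' : Scheme.{0}) (π : T' ⟶ T), J ≠ ⊥ ∧
          (∀ t : T, t ∈ J.support → ¬ IsRegularLocalRing (T.presheaf.stalk t)) ∧
          IsBlowup π J ∧ Scheme.IsRegular T')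
    (B M : Scheme.{0}) (gB : B ⟶ Spec (.of k)) [LocallyOfFiniteType gB] [QuasiCompact gB]
    [IsIntegral B] (hB : Scheme.IsRegular B) (hdimB : topologicalKrullDim B ≤ d)
    (q : M ⟶ B) [IsProper q] [IsIntegral M] (hq : IsBirational q) :
    ∃ (J : M.IdealSheafData) (M' : Scheme.{0}) (π : M' ⟶ M), IsBlowup π J ∧
      genericPoint M ∉ (J.support : Set M) ∧
      (∃ F : Set B, F.Finite ∧ (∀ n ∈ F, IsClosed ({n} : Set B)) ∧
        ∀ m : M, m ∈ J.support → m ∉ Scheme.regularLocus M ∨ q.base m ∈ F) ∧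
      Scheme.IsRegular M' := by
  sorry

/-- **STUB E2 — GLUING FINITELY MANY REGULAR ROOFS (true).** Let `N` be an integral separated
`k`-scheme of finite type with finitely many proper birational dominations `q i : N → N' i` onto
integral finite-type `k`-schemes of dimension `≤ d` such that every point of `N` has a regular
image under some `q i`. If the engine over one regular base (E1's conclusion, hypothesis `hE`)
is available, then `N` has a resolution. PROOF PATTERN: order `ι`; `U i := (q i)⁻¹(Reg (N' i))`
(open: `isClosed_compl_regularLocus_of_locallyOfFiniteType`); process `i` one at a time keeping a
proper birational `h_j : N_j → N` with `N_j` integral and REGULAR OVER `U i` for the processed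
`i`: apply `hE` to `B = Reg (N' i)` (as an open subscheme), `M = (h_j ≫ q i)⁻¹(Reg (N' i))`,
the restricted morphism (proper, birational); extend the resulting blowing up from the open `M` to
`N_j` by `Theorems.exists_isPullback_of_isBlowup_opens` (centre `J.map ι`, cosupport = closure of
`Supp J ⊆ Sing M ∪ (fibres over finitely many closed roof points)` — the first part closes up
inside `Sing N_j`, which lies over no processed `U i'`, the second is already closed in `N_j` and
inside `M`); so the new model is regular over `U i` and, the extension being an isomorphism off
its cosupport (`IsBlowup.isIso_compl`, `mem_regularLocus_iff_of_isIso_morphismRestrict`), still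
regular over the processed `U i'`. At the end the model is regular over `⋃ U i = N`.
[cite: Piltant2013, Prop. 5.1 (proof, Step 2)] [cite: Temkin2008, Lemma 2.1.4] -/
theorem stub_multiRoofGluing (d : ℕ) (k : Type) [Field k]
    (hE : ∀ (B M : Scheme.{0}) (gB : B ⟶ Spec (.of k)) [LocallyOfFiniteType gB] [QuasiCompact gB]
      [IsIntegral B], Scheme.IsRegular B → topologicalKrullDim B ≤ d →
      ∀ (q : M ⟶ B) [IsProper q] [IsIntegral M], IsBirational q →
        ∃ (J : M.IdealSheafData) (M' : Scheme.{0}) (π : M' ⟶ M), IsBlowup π J ∧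
          genericPoint M ∉ (J.support : Set M) ∧
          (∃ F : Set B, F.Finite ∧ (∀ n ∈ F, IsClosed ({n} : Set B)) ∧
            ∀ m : M, m ∈ J.support → m ∉ Scheme.regularLocus M ∨ q.base m ∈ F) ∧
          Scheme.IsRegular M')
    (N : Scheme.{0}) (gN : N ⟶ Spec (.of k)) [IsSeparated gN] [LocallyOfFiniteType gN]
    [QuasiCompact gN] [IsIntegral N] (ι : Type) [Finite ι] (N' : ι → Scheme.{0})
    (g' : (i : ι) → (N' i ⟶ Spec (.of k))) [∀ i, LocallyOfFiniteType (g' i)]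
    [∀ i, QuasiCompact (g' i)] [∀ i, IsIntegral (N' i)]
    (hdim : ∀ i, topologicalKrullDim (N' i) ≤ d)
    (q : (i : ι) → (N ⟶ N' i)) [∀ i, IsProper (q i)] (hq : ∀ i, IsBirational (q i))
    (hcov : ∀ n : N, ∃ i, IsRegularLocalRing ((N' i).presheaf.stalk ((q i).base n))) :
    Scheme.HasResolution N := by
  sorry

/-- **STUB E3 — THE SLICE IN ALL DIMENSIONS (true; Zariski's setup).** For a field `k` with
relative local uniformization over `k` and the roof-family resolver (E2's conclusion, hypothesis
`hR`), every integral separated `k`-scheme of finite type has a resolution. PROOF PATTERN: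
`PatchingRelPerfect.SliceOfEngine.hasResolution_projective_of_dim_le_four` and
`Theorems.stub_sliceOfEngine` WITHOUT the dimension case split: reduction to integral closed
subschemes of `ℙⁿ_k` (`ResolutionOverUpToDim.of_projective` at `d = dim X`, or directly); affine
chart, `K = Frac A`, `X` as a projective model `M₀`; `trdeg_k K = m`
(`exists_ringKrullDim_eq_and_trdeg_eq`); LU at `k` in the fibrewise shape ⇒ finite resolving
system (`exists_hasRegularCentre_of_relLU`, `exists_finite_resolvingSystem'`) ⇒ proper models
(`ProjModel.exists_regCentre_of_hasRegularCentre`) ⇒ iterated join `N`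
(`exists_hom_forall_nonempty_hom`) with chosen dominations `q i` onto the members (finite index:
the list), every point regularly roofed (`exists_roof` pattern:
`KModel.exists_isCentre_of_isGenericPoint`, `ProperModel.Hom.map_centre`), all members of
dimension `m` (`properModel_topologicalKrullDim_eq_of_trdeg`); `hR` resolves `N`; transfer along
`N → M₀ = X` (`Scheme.HasResolution.of_isBirational`).
[cite: Zariski1944, p. 539] [cite: Piltant2013, Prop. 5.1 and Cor. 5.7] -/
theorem stub_sliceAllDim (k : Type) [Field k]
    (hLU : ∀ (K : Type) [Field K] [Algebra k K], (⊤ : IntermediateField k K).FG →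
      ∀ O : ValuationSubring K, (∀ c : k, algebraMap k K c ∈ O) → ∀ R : Subalgebra k K, R.FG →
        R.toSubring ≤ O.toSubring → ∃ (A : Subalgebra k K) (h : A.toSubring ≤ O.toSubring),
          R ≤ A ∧ A.FG ∧ IsFractionRing A K ∧ IsRegularLocalRing (Localization.AtPrime
            (Ideal.comap (Subring.inclusion h) (IsLocalRing.maximalIdeal O))))
    (hR : ∀ (d : ℕ) (N : Scheme.{0}) (gN : N ⟶ Spec (.of k)) [IsSeparated gN]
      [LocallyOfFiniteType gN] [QuasiCompact gN] [IsIntegral N] (ι : Type) [Finite ι]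
      (N' : ι → Scheme.{0}) (g' : (i : ι) → (N' i ⟶ Spec (.of k)))
      [∀ i, LocallyOfFiniteType (g' i)] [∀ i, QuasiCompact (g' i)] [∀ i, IsIntegral (N' i)],
      (∀ i, topologicalKrullDim (N' i) ≤ d) →
      ∀ (q : (i : ι) → (N ⟶ N' i)) [∀ i, IsProper (q i)], (∀ i, IsBirational (q i)) →
        (∀ n : N, ∃ i, IsRegularLocalRing ((N' i).presheaf.stalk ((q i).base n))) →
        Scheme.HasResolution N)
    (X : Scheme.{0}) (f : X ⟶ Spec (.of k)) [IsSeparated f] [LocallyOfFiniteType f]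
    [QuasiCompact f] [IsIntegral X] : Scheme.HasResolution X := by
  sorry

/-- **STUB E5 — THE NON-CLOSED ATOM BELOW THE FRONTIER (true modulo the printed inputs).** For a
regular local ring `S` essentially of finite type over a field `k` with `dim S ≤ 3` and an
integral `T` proper and birational over `Spec S`, regular off the closed fibre: a non-zero ideal
sheaf on `T` cosupported in `Sing T` whose blowing up is regular. PROOF PATTERN:
`Theorems.stub_atomDimLeThree` with the eft base in place of the complete one: `T` is Noetherian,
separated, EXCELLENT (of finite type over `S`, a localization of a finitely generated `k`-algebra)
of dimension `≤ 3` (`topologicalKrullDim_le_of_isProper_of_isBirational`); `dim T ≤ 2`: `hCJS`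
(Sing-supported by definition of `IsDesingularization`); `dim T = 3`: CP Thm. 1.1 strong resolution
+ Prop. 4.4 in blow-up format (`formatPrincipalization_dim3_of_cossartPiltant`) + the format
upgrade `exists_isBlowup_supported_isRegular_of_isIso_over` ⇒ ONE `Sing T`-supported blowing up
with regular source; non-zero since its cosupport misses the generic point.
[cite: CossartPiltant2019, Thm. 1.1 and Prop. 4.4] [cite: CossartJannsenSaito2020, Thm. 1.2] -/
theorem stub_nonClosedAtomDimLeThree
    (hG : CossartPiltant2019General.{0}) (hP : CossartPiltant2019Principalization.{0})
    (hCJS : ∀ (X : Scheme.{0}) [IsNoetherian X] [IsReduced X], Scheme.IsExcellent X →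
      topologicalKrullDim X ≤ 2 → Scheme.AdmitsDesingularization X)
    (k : Type) [Field k] (S : Type) [CommRing S] [IsRegularLocalRing S] [Algebra k S]
    [Algebra.EssFiniteType k S] (hdim : ringKrullDim S ≤ (3 : ℕ))
    (T : Scheme.{0}) (f : T ⟶ Spec (.of S)) [IsIntegral T] [IsProper f] (hbir : IsBirational f)
    (hoff : ∀ t : T, f.base t ≠ IsLocalRing.closedPoint S → IsRegularLocalRing (T.presheaf.stalk t)) :
    ∃ (J : T.IdealSheafData) (T' : Scheme.{0}) (π : T' ⟶ T), J ≠ ⊥ ∧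
      (∀ t : T, t ∈ J.support → ¬ IsRegularLocalRing (T.presheaf.stalk t)) ∧
      IsBlowup π J ∧ Scheme.IsRegular T' := by
  sorry

/-! ## The stub statements are exactly the stubs (faithfulness, proved) -/

/-- [folklore] -/
theorem sig_printedInputs : Sig.stub_printedInputs := stub_printedInputs

/-- [folklore] -/
theorem sig_atomDimFour : Sig.stub_atomDimFour :=
  fun p hp S _ _ _ _ _ hdim T f hT hf hbir hoff => @stub_atomDimFour p hp S _ _ _ _ _ hdim T f hT hf hbir hoff

/-- [folklore] -/
theorem sig_higherAtoms : Sig.stub_higherAtoms :=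
  ⟨fun p hp k _ _ _ S _ _ _ _ h4 hfin T f hT hf hbir hoff =>
      stub_higherAtoms.1 p hp k S h4 hfin T f hT hf hbir hoff,
    fun p hp k _ _ _ S _ _ _ _ h3 hfin T f hT hf hbir hoff =>
      stub_higherAtoms.2 p hp k S h3 hfin T f hT hf hbir hoff⟩

/-- [folklore] -/
theorem sig_regularBaseEngine : Sig.stub_regularBaseEngine :=
  fun d k _ hC hN B M gB _ _ _ hB hdimB q _ _ hq =>
    stub_regularBaseEngine d k
      (fun S _ _ _ _ hdim hfin T f hT hf hbir hoff => hC S hdim hfin T f hT hf hbir hoff)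
      (fun S _ _ _ _ hdim hfin T f hT hf hbir hoff => hN S hdim hfin T f hT hf hbir hoff)
      B M gB hB hdimB q hq

/-- [folklore] -/
theorem sig_multiRoofGluing : Sig.stub_multiRoofGluing :=
  fun d k _ hE N gN _ _ _ _ ι _ N' g' _ _ _ hdim q _ hq hcov =>
    stub_multiRoofGluing d k (fun B M gB _ _ _ hB hdimB q _ _ hq => hE B M gB hB hdimB q hq)
      N gN ι N' g' hdim q hq hcov

/-- [folklore] -/
theorem sig_sliceAllDim : Sig.stub_sliceAllDim :=
  fun k _ hLU hR X f hs hl hq hi =>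
    @stub_sliceAllDim k _ hLU (fun d N gN _ _ _ _ ι _ N' g' _ _ _ hdim q _ hq hcov =>
      hR d N gN ι N' g' hdim q hq hcov) X f hs hl hq hi

/-- [folklore] -/
theorem sig_nonClosedAtomDimLeThree : Sig.stub_nonClosedAtomDimLeThree :=
  fun h1 k _ S _ _ _ _ hdim T f hT hf hbir hoff =>
    @stub_nonClosedAtomDimLeThree h1.1 h1.2.1 h1.2.2 k _ S _ _ _ _ hdim T f hT hf hbir hoff

/-! ## The composition (kernel-checked; no `sorry` in its own term) -/

/-- **The closed atom of dimension `≤ 4` at regular local `k`-algebras essentially of finite type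
with residue field finite over `k`** (`k` perfect of characteristic `p`), from the printed inputs
and the shared complete atom through the LANDED algebraization `Theorems.stub_algebraizeBlowup`
(completion: regular, dimension preserved, characteristic `p`, residue field finite over the
perfect `k`, hence perfect). [cite: Temkin2008, Thm. 3.4.1 (algebraization pattern)] -/
theorem closedAtomDimLeFour_of (h1 : Sig.stub_printedInputs) (h2 : Sig.stub_atomDimFour)
    (p : ℕ) (hp : p.Prime) (k : Type) [Field k] [CharP k p] [PerfectField k] (S : Type)
    [CommRing S] [IsRegularLocalRing S] [Algebra k S] [Algebra.EssFiniteType k S]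
    (h4 : ringKrullDim S ≤ (4 : ℕ)) (hfin : Module.Finite k (S ⧸ IsLocalRing.maximalIdeal S)) :
    AtomAt S := by
  intro T f hT hf hbir hoff
  obtain ⟨hG, hP, hCJS⟩ := h1
  have hAtom : ∀ (S : Type) [CommRing S] [IsRegularLocalRing S] [CharP S p]
      [IsAdicComplete (IsLocalRing.maximalIdeal S) S]
      [PerfectField (IsLocalRing.ResidueField S)], ringKrullDim S ≤ (4 : ℕ) →
      ∀ (T : Scheme.{0}) (f : T ⟶ Spec (.of S)), IsIntegral T → IsProper f → IsBirational f →
        (∀ t : T, f.base t ≠ IsLocalRing.closedPoint S →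
          IsRegularLocalRing (T.presheaf.stalk t)) →
        ∃ (J : T.IdealSheafData) (T' : Scheme.{0}) (π : T' ⟶ T), J ≠ ⊥ ∧
          (∀ t : T, t ∈ J.support → f.base t = IsLocalRing.closedPoint S) ∧
          IsBlowup π J ∧ Scheme.IsRegular T' :=
    fun S _ _ _ _ _ hdim T fT hT hfT hbir hoff =>
      @punctualCompletePerfect_four_of_printed_of_atomDimFour p hp hG hP hCJS
        (fun S _ _ _ _ _ hdim T f hT hf hbir hoff => h2 p hp S hdim T f hT hf hbir hoff)
        S _ _ _ _ _ hdim T fT hT hfT hbir hoff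
  haveI := hT
  haveI := hf
  exact stub_algebraizeBlowup p hp hAtom k S h4 hfin T f hbir hoff

/-- **The closed atoms in every dimension**: dimension `≤ 4` by `closedAtomDimLeFour_of`,
dimension `≥ 5` is the first conjunct of `stub_higherAtoms`. [folklore] -/
theorem closedAtoms_of (h1 : Sig.stub_printedInputs) (h2 : Sig.stub_atomDimFour)
    (h34 : Sig.stub_higherAtoms) (p : ℕ) (hp : p.Prime) (k : Type) [Field k] [CharP k p]
    [PerfectField k] (S : Type) [CommRing S] [IsRegularLocalRing S] [Algebra k S]
    [Algebra.EssFiniteType k S] (hfin : Module.Finite k (S ⧸ IsLocalRing.maximalIdeal S)) :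
    AtomAt S := by
  by_cases h4 : ringKrullDim S ≤ (4 : ℕ)
  · exact closedAtomDimLeFour_of h1 h2 p hp k S h4 hfin
  · exact h34.1 p hp k S h4 hfin

/-- **The non-closed atoms in every dimension** (residue field not finite over `k`): dimension
`≤ 3` is E5 (printed), dimension `≥ 4` is the second conjunct of `stub_higherAtoms`. [folklore] -/
theorem nonClosedAtoms_of (h1 : Sig.stub_printedInputs) (h34 : Sig.stub_higherAtoms)
    (hE5 : Sig.stub_nonClosedAtomDimLeThree) (p : ℕ) (hp : p.Prime) (k : Type) [Field k]
    [CharP k p] [PerfectField k] (S : Type) [CommRing S] [IsRegularLocalRing S]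
    [Algebra k S] [Algebra.EssFiniteType k S]
    (hfin : ¬ Module.Finite k (S ⧸ IsLocalRing.maximalIdeal S)) : SingAtomAt S := by
  by_cases h3 : ringKrullDim S ≤ (3 : ℕ)
  · exact hE5 h1 k S h3
  · exact h34.2 p hp k S h3 hfin

/-- **`PatchingPerfect` from the seven stub statements.** Fix `p`, a perfect `k`, LU over `k` and
a reduced separated `X/k` of finite type; reduce to the integral closed subschemes of `X` over the
same `k` (`hasResolution_of_forall_closeds`); resolve each by the all-dimensional slice (E3) fed
by the roof-family resolver (E2) fed by the regular-base engine (E1) fed by the closed atoms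
(`closedAtoms_of`: printed + `stub_atomDimFour` + higher closed atoms) and the non-closed atoms
(`nonClosedAtoms_of`: E5 + higher non-closed atoms). [cite: Zariski1944, p. 539]
[cite: Piltant2013, Prop. 5.1 and Cor. 5.7] [cite: Temkin2008, Prop. 2.3.4] -/
theorem PatchingPerfect_of :
    Sig.stub_printedInputs → Sig.stub_atomDimFour → Sig.stub_higherAtoms →
      Sig.stub_regularBaseEngine → Sig.stub_multiRoofGluing → Sig.stub_sliceAllDim →
      Sig.stub_nonClosedAtomDimLeThree → PatchingPerfect := by
  intro h1 h2 h34 hE1 hE2 hE3 hE5 p hp k _ _ _ hLU X f hsep hft hqc hred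
  refine hasResolution_of_forall_closeds X f fun Z hZ => ?_
  haveI := hZ
  let ι := (Scheme.IdealSheafData.vanishingIdeal Z).subschemeι
  -- the engine over one regular base, at `k`, in every dimension `d`
  have hE : ∀ (d : ℕ) (B M : Scheme.{0}) (gB : B ⟶ Spec (.of k)) [LocallyOfFiniteType gB]
      [QuasiCompact gB] [IsIntegral B], Scheme.IsRegular B → topologicalKrullDim B ≤ d →
      ∀ (q : M ⟶ B) [IsProper q] [IsIntegral M], IsBirational q → EngineOut q :=
    fun d B M gB _ _ _ hB hdimB q _ _ hq =>
      hE1 d k (fun S _ _ _ _ _ hfin => closedAtoms_of h1 h2 h34 p hp k S hfin)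
        (fun S _ _ _ _ _ hfin => nonClosedAtoms_of h1 h34 hE5 p hp k S hfin)
        B M gB hB hdimB q hq
  -- the roof-family resolver at `k`
  have hR : RoofFamiliesResolve k :=
    fun d N gN _ _ _ _ ι _ N' g' _ _ _ hdim q _ hq hcov =>
      hE2 d k (hE d) N gN ι N' g' hdim q hq hcov
  exact hE3 k hLU hR _ (ι ≫ f) inferInstance inferInstance inferInstance hZ

/-- **The crux `PatchingPerfect`, assembled from the registered stubs** (the skeleton in its v5
shape; the only `sorry`s in its closure are the seven stubs). -/
theorem PatchingPerfect_proof : PatchingPerfect :=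
  PatchingPerfect_of sig_printedInputs sig_atomDimFour sig_higherAtoms sig_regularBaseEngine
    sig_multiRoofGluing sig_sliceAllDim sig_nonClosedAtomDimLeThree

/-- The same composition for the `IndSmooth` copy of the shared crux (the same term). [folklore] -/
theorem indSmooth_PatchingPerfect_of :
    Sig.stub_printedInputs → Sig.stub_atomDimFour → Sig.stub_higherAtoms →
      Sig.stub_regularBaseEngine → Sig.stub_multiRoofGluing → Sig.stub_sliceAllDim →
      Sig.stub_nonClosedAtomDimLeThree →
      Summit.ResolutionOfSingularities.ResolutionOfSingularities.Theses.IndSmooth.PatchingPerfect :=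
  PatchingPerfect_of

/-- The `IndSmooth` copy, assembled from the stubs. [folklore] -/
theorem indSmooth_PatchingPerfect_proof :
    Summit.ResolutionOfSingularities.ResolutionOfSingularities.Theses.IndSmooth.PatchingPerfect :=
  indSmooth_PatchingPerfect_of sig_printedInputs sig_atomDimFour sig_higherAtoms
    sig_regularBaseEngine sig_multiRoofGluing sig_sliceAllDim sig_nonClosedAtomDimLeThree

/-! ## Book-keeping (proved): the dimension-4 slice needs no higher atom -/

/-- Arithmetic in `WithBot ℕ∞`: `x < 4 → x ≤ 3`. [folklore] -/
theorem le_three_of_lt_four {x : WithBot ℕ∞} (h : x < ((4 : ℕ) : WithBot ℕ∞)) :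
    x ≤ ((3 : ℕ) : WithBot ℕ∞) := by
  induction x using WithBot.recBotCoe with
  | bot => exact bot_le
  | coe y =>
    have h' : y < (4 : ℕ) := by
      rw [show ((4 : ℕ) : WithBot ℕ∞) = (((4 : ℕ) : ℕ∞) : WithBot ℕ∞) from rfl] at h
      exact WithBot.coe_lt_coe.mp h
    rw [show ((3 : ℕ) : WithBot ℕ∞) = (((3 : ℕ) : ℕ∞) : WithBot ℕ∞) from rfl]
    refine WithBot.coe_le_coe.mpr ?_
    induction y using ENat.recTopCoe with
    | top => exact absurd h' (by simp)
    | coe m =>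
      have hm : m < 4 := by exact_mod_cast h'
      have hm3 : m ≤ 3 := by omega
      exact_mod_cast hm3

/-- **At `d = 4` the engine E1 is fed by the v4 / stmt-16161 inputs alone**: closed points meet
`closedAtomDimLeFour_of` (printed + `stub_atomDimFour`), non-closed points have `dim < 4`, i.e.
`≤ 3`, and meet E5 — WITHOUT the sibling's generic-fibre step and without `stub_higherAtoms`.
[folklore] -/
theorem engineInputs_dimFour_of (h1 : Sig.stub_printedInputs) (h2 : Sig.stub_atomDimFour)
    (hE5 : Sig.stub_nonClosedAtomDimLeThree) (p : ℕ) (hp : p.Prime) (k : Type) [Field k]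
    [CharP k p] [PerfectField k] :
    (∀ (S : Type) [CommRing S] [IsRegularLocalRing S] [Algebra k S] [Algebra.EssFiniteType k S],
      ringKrullDim S ≤ ((4 : ℕ) : ℕ) → Module.Finite k (S ⧸ IsLocalRing.maximalIdeal S) →
        AtomAt S) ∧
    (∀ (S : Type) [CommRing S] [IsRegularLocalRing S] [Algebra k S] [Algebra.EssFiniteType k S],
      ringKrullDim S < ((4 : ℕ) : ℕ) → ¬ Module.Finite k (S ⧸ IsLocalRing.maximalIdeal S) →
        SingAtomAt S) := by
  refine ⟨fun S _ _ _ _ hd hfin => closedAtomDimLeFour_of h1 h2 p hp k S hd hfin,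
    fun S _ _ _ _ hd _ => ?_⟩
  exact hE5 h1 k S (le_three_of_lt_four hd)

end Summit.ResolutionOfSingularities.ResolutionOfSingularities.Cruxes.PatchingPerfect.Lines.Birth

end
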